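/-
Origin: expansion seat `literature-prover-pub-hodgecm-cf-kudla-howe-rallis-g5-0`, handover #4 2026-08-18T10:01:07Z (`HOME/pub-hodgecm-cf-kudla-howe-rallis-g5/lean/CfKHRg5/N17CoverLink.lean`, md5 b7e6b502, 145 lines);
landed by the gen-7 packager in gate run 28 as `HodgeCM/PerL34/N17CoverLink.lean` (verbatim).
-/
/-
Origin: HOME/pub-hodgecm-cf-kudla-howe-rallis-g5/lean/CfKHRg5/N17CoverLink.lean — session
literature-prover-pub-hodgecm-cf-kudla-howe-rallis-g5-0 (unit pub-hodgecm-cf-kudla-howe-rallis-g5, CITED-FACT seat (4) gen 5), 2026-08-18.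
Intended place: `HodgeCM/PerL34/N17CoverLink.lean` (NEW, ADDITIVE LEAF; imports `HodgeCM.Automorphic.ThetaPending` (landed,
v4 doc-only in run 27 — code identical) and this seat's `HodgeCM.PerL34.N17FromLiterature` (run 27, installed in place
2026-08-18T09:5xZ; NO import rewrite needed; HOLD this file if that one is bounced at the run-27 gate); nothing imports it).  KERNEL sanity link,
nothing cited anew, nothing posited.  Companion prose: HOME/CITED-FACTS.md § pub-hodgecm-cf-kudla-howe-rallis-g5, KHR-32.
-/
import Summits.HodgeConjecture.HodgeCM.Automorphic.ThetaPending_2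
import Summits.HodgeConjecture.HodgeCM.PerL34.N17FromLiterature

set_option autoImplicit false

/-!
# Sanity link: the hypotheses of `N17FromLiterature.CoverData` ARE the lineage's `ThetaPending.SeesawCover` statements

`HodgeCM/PerL34/N17FromLiterature.lean` derives pv11's `ThetaSeesawData.RestrictTmul` from four hypotheses on bare
`CoverData` over pv11's lattice shell, two of which were described there as "the SHAPE of" statements of this lineage's
`HodgeCM.Automorphic.ThetaPending.WeilProductDatum.SeesawCover` (which lives over `ℂ`-linear carriers): `IsPullback` and
`GUsideCompatible` (= `Pending_GUsideCompatible`, DERIVED in the kernel since gate run 24).  This file checks the word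
"shape" in the kernel: for a `WeilProductDatum D` with cover `C : D.SeesawCover`, ANY lattice data completing `D`'s
carriers to a `ThetaSeesawData` (`ofWeilProduct`: index sets, evaluation maps; `tmul := (x₁, x₂) ↦ e (x₁ ⊗ₜ x₂)` for a
chosen identification `e : S₁ ⊗ S₂ ≃ₗ S`; the actions forgotten to bare functions) carries the cover data
`coverOf C`, and then

* `isPullback_iff`        : `(coverOf C e).IsPullback ↔ C.IsPullback`;
* `guside_iff`            : `(coverOf C e).GUsideCompatible ↔ C.Pending_GUsideCompatible`;
* `splittingRestricts_iff`: `(coverOf C e).toHKSRestrictionDatum.SplittingRestricts ↔ C.toHKSRestrictionDatum.SplittingRestricts`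
                            (both are [HKS96 Cor. A.3] BY NAME, on the same groups);
* `kudlaTensorPure_of`    : Kudla's tensor compatibility for `e` (the hypothesis `hKu` of `ThetaPending … of_parts`, i.e.
                            `MetaplecticSumDatum.WeilRepMultiplicative`'s typing sentence for this `e`) ⇒ `KudlaTensorPure`;
* `restrictTmul_of_seesawCover`: hence pv11's `RestrictTmul` for such data from `C.IsPullback`, `hKu`,
  [HKS96 Cor. A.3] and `C.Pending_GUsideCompatible` — the last being exactly what
  `SeesawCover.pending_GUsideCompatible_of_descent` (SeesawSplittingDescent.lean, run 24) proves.

So for covers presented as in [HKS96 §1] the four hypotheses of `restrictTmul_of_cover` are, respectively, DEFINITIONAL,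
[MVW 2.II.1 Rem (6)]/[Ku96 (**)] for the chosen `e`, [HKS96 Cor. A.3] by name, and a kernel theorem of the package —
no statement of PerL/[Y1neg]/[QW8] and no new citation.  (Universe: pv11's shell is `Type`-valued, so `D` is taken in
`WeilProductDatum.{0}`.)
-/

namespace HodgeCM.PerL34.N17.N17CoverLink

open scoped TensorProduct
open HodgeCM.PerL34.Seesaw HodgeCM.Literature.Theta HodgeCM.Automorphic.ThetaPending
open HodgeCM.PerL34.N17.N17FromLiterature

variable (D : WeilProductDatum.{0})

/-- pv11's lattice shell on the lineage's carriers: groups `G := D.H` (`G_U`), `A₁ := D.G₁`, `A₂ := D.G₂` (`U(W_j)`),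
spaces `D.S₁, D.S₂, D.S` with the actions forgotten to bare functions, `tmul` through a chosen identification
`e : S₁ ⊗ S₂ ≃ₗ S`, and ARBITRARY index sets / evaluation maps (the lattice data pv11's theta series need; irrelevant
to assertion 2 of Lemma 3.4). -/
def ofWeilProduct (e : D.S₁ ⊗[ℂ] D.S₂ ≃ₗ[ℂ] D.S) (X₁ X₂ : Type) (ev₁ : D.S₁ → X₁ → ℂ) (ev₂ : D.S₂ → X₂ → ℂ)
    (ev : D.S → X₁ × X₂ → ℂ) : ThetaSeesawData where
  G := D.H
  A₁ := D.G₁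
  A₂ := D.G₂
  X₁ := X₁
  X₂ := X₂
  S₁ := D.S₁
  S₂ := D.S₂
  S := D.S
  ev₁ := ev₁
  ev₂ := ev₂
  ev := ev
  tmul := fun x₁ x₂ => e (x₁ ⊗ₜ[ℂ] x₂)
  ω₁ := fun g u₁ φ₁ => D.ω₁ u₁ g φ₁
  ω₂ := fun g u₂ φ₂ => D.ω₂ u₂ g φ₂
  ωW := fun g t Φ => D.ω t.1 t.2 g Φ

variable {D}
variable (C : D.SeesawCover) (e : D.S₁ ⊗[ℂ] D.S₂ ≃ₗ[ℂ] D.S) (X₁ X₂ : Type)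
  (ev₁ : D.S₁ → X₁ → ℂ) (ev₂ : D.S₂ → X₂ → ℂ) (ev : D.S → X₁ × X₂ → ℂ)

/-- The cover data of `N17FromLiterature` carried by a `SeesawCover` (same groups, `j̃`, splittings; the Weil
representations of the covers forgotten to bare functions). -/
def coverOf : CoverData (ofWeilProduct D e X₁ X₂ ev₁ ev₂ ev) where
  UW := C.G
  M := C.M
  M₁ := C.M₁
  M₂ := C.M₂
  incl := C.incl
  jt := C.jt
  Ω := fun m Φ => C.Ω m Φ
  Ω₁ := fun m₁ φ₁ => C.Ω₁ m₁ φ₁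
  Ω₂ := fun m₂ φ₂ => C.Ω₂ m₂ φ₂
  ιW := C.ιW
  ιW₁ := C.ιW₁
  ιW₂ := C.ιW₂
  ιV := C.ιV
  ιV₁ := C.ιV₁
  ιV₂ := C.ιV₂

/-- `IsPullback` of the cover data IS `SeesawCover.IsPullback` (the DEFINITION of the three Weil representations as
pullbacks along the splittings), read on vectors. -/
theorem isPullback_iff :
    (coverOf C e X₁ X₂ ev₁ ev₂ ev).IsPullback ↔ C.IsPullback := by
  constructor
  · rintro ⟨hW, h1, h2⟩
    refine ⟨fun g₁ g₂ h => ?_, fun g₁ h => ?_, fun g₂ h => ?_⟩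
    · exact LinearMap.ext fun Φ => hW h g₁ g₂ Φ
    · exact LinearMap.ext fun φ₁ => h1 h g₁ φ₁
    · exact LinearMap.ext fun φ₂ => h2 h g₂ φ₂
  · rintro ⟨hW, h1, h2⟩
    refine ⟨fun g u₁ u₂ Φ => ?_, fun g u₁ φ₁ => ?_, fun g u₂ φ₂ => ?_⟩
    · exact LinearMap.congr_fun (hW u₁ u₂ g) Φ
    · exact LinearMap.congr_fun (h1 u₁ g) φ₁
    · exact LinearMap.congr_fun (h2 u₂ g) φ₂

/-- `GUsideCompatible` of the cover data IS `SeesawCover.Pending_GUsideCompatible` — the statement DERIVED in the kernel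
by `SeesawCover.pending_GUsideCompatible_of_descent` (SeesawSplittingDescent.lean, run 24). -/
theorem guside_iff :
    (coverOf C e X₁ X₂ ev₁ ev₂ ev).GUsideCompatible ↔ C.Pending_GUsideCompatible :=
  Iff.rfl

/-- The two `HKSRestrictionDatum`s ([HKS96 Cor. A.3] carriers) agree: `SplittingRestricts` is the same statement. -/
theorem splittingRestricts_iff :
    (coverOf C e X₁ X₂ ev₁ ev₂ ev).toHKSRestrictionDatum.SplittingRestricts ↔
      C.toHKSRestrictionDatum.SplittingRestricts :=
  Iff.rfl

/-- Kudla's tensor compatibility for the identification `e` (the hypothesis `hKu` of `ThetaPending … SeesawCover.of_parts`;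
= the typing sentence of `MetaplecticSumDatum.WeilRepMultiplicative` for this `e`) gives `KudlaTensorPure` of the cover data. -/
theorem kudlaTensorPure_of
    (hKu : ∀ (m₁ : C.M₁) (m₂ : C.M₂) (x₁ : D.S₁) (x₂ : D.S₂),
      e (C.Ω₁ m₁ x₁ ⊗ₜ[ℂ] C.Ω₂ m₂ x₂) = C.Ω (C.jt (m₁, m₂)) (e (x₁ ⊗ₜ[ℂ] x₂))) :
    (coverOf C e X₁ X₂ ev₁ ev₂ ev).KudlaTensorPure :=
  fun m₁ m₂ x₁ x₂ => hKu m₁ m₂ x₁ x₂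

/-- **pv11's `RestrictTmul` for shells built on the lineage's carriers**, from `SeesawCover.IsPullback` (definition),
Kudla's tensor compatibility for `e`, [HKS96 Cor. A.3] by name, and `Pending_GUsideCompatible` (derived, run 24) —
`N17FromLiterature.CoverData.restrictTmul_of_cover` through the three `iff`s above. -/
theorem restrictTmul_of_seesawCover (hP : C.IsPullback)
    (hKu : ∀ (m₁ : C.M₁) (m₂ : C.M₂) (x₁ : D.S₁) (x₂ : D.S₂),
      e (C.Ω₁ m₁ x₁ ⊗ₜ[ℂ] C.Ω₂ m₂ x₂) = C.Ω (C.jt (m₁, m₂)) (e (x₁ ⊗ₜ[ℂ] x₂)))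
    (hA3 : C.toHKSRestrictionDatum.SplittingRestricts) (hV : C.Pending_GUsideCompatible) :
    (ofWeilProduct D e X₁ X₂ ev₁ ev₂ ev).RestrictTmul :=
  CoverData.restrictTmul_of_cover
    ((isPullback_iff C e X₁ X₂ ev₁ ev₂ ev).mpr hP)
    (kudlaTensorPure_of C e X₁ X₂ ev₁ ev₂ ev hKu)
    ((splittingRestricts_iff C e X₁ X₂ ev₁ ev₂ ev).mpr hA3)
    ((guside_iff C e X₁ X₂ ev₁ ev₂ ev).mpr hV)

end HodgeCM.PerL34.N17.N17CoverLink
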